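import Summits.AtomisticToContinuum.Crystallization.Theorems.ChartedZeroExcessLayeredLatticeLiouvilleYD

/-!
(SPLIT FOR THE 400-LINE CAP by the landing lane, hand-2 g32: this file = part 1 of 2; sequels `…ChartedZeroExcessLayeredLatticeLiouvilleYE` import it in a chain; same namespace, all FQNs unchanged.)
# Charted zero-excess layered lattice Liouville — part YE «SereneCut»: the B-body as ONE functional `CountSparseBPG`, the CHARGING calculus (PROVED),
# the ball caveat of [TISᵇ] absorbed — `[ISᵇ₀] ⟸ [HSᵇ] ∧ [TBISᵇ(r)]` (PROVED) — and the lens-2 cut of the IDEA-NEEDED leaf [BHSᵇ] by the OBSERVABLE FAR FIELD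
# of the hot network: `[BHSᵇ] ⟸ [SBHSᵇ] ∧ [FWSᵇ] ⟸ [SBHSᵇ] ∧ [TBISᵇ]` (PROVED); column `_16XH23B`

Docket `stmt-AtomisticToContinuum-26636` (N = `ChartedPlanarOrder.ChartedZeroExcessLayered`), cell decomp-a2c, seat lens-2 g62 (lens «structural dichotomy (special vs generic)»;
CRITIC-LEDGER row 1174: column of record `_16XH22Bᶜ` = 20 generic leaves + [I_D] `DressedCorePG` + [BHSᵇ] `BareHotSparseBPG` (IDEA-NEEDED: source chains) + [TISᵇ]
`TameIncoherenceSparseBPG` (ATTACKABLE·L modulo the BALL caveat) + `PeriodicBulkGapDoor 2`; NEXT (i) type `[TISᵇ] ⟸ (M) ∧ (K) on tame BALLS` with hot-neighbourhood absorption,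
(ii) a MECHANISM for [BHSᵇ]).

* YE-0 ★ THE B-BODY AS A FUNCTIONAL.  `CountSparseBPG cnt aHi Λ θ s` := the common body of parts YC/YD's sparse leaves (door `S`, θ-good, `η ≤ η₁`, `R ≥ R₁`, equilibrium chart,
  `(Cg, η, R)`-registered bond isomorphism `Ψ`, `K₀`-fat window) `→ cnt S H Ψ (win R) ≤ εw·η·nK(win R)` over a WINDOW FUNCTIONAL `cnt S H Ψ Q`; the four leaves of record are
  `CountSparseBPG` of their functionals by `Iff.rfl`.  CALCULUS (PROVED, used for every arrow below): `CountSparseBPG.of_pointwise_le` (sub-count ⇒ weaker leaf) and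
  ★ `CountSparseBPG.of_le_add_mul` — THE CHARGING GLUE: if `cntA(win R) ≤ cntB(win R) + C(δ)·cntC(win (R + ρ))` on every `δ`-separated `S`, and `cntC` is monotone in the window,
  then `[B sparse] ∧ [C sparse] ⇒ [A sparse]` on `aHi ≤ 8/7` door sets — the `C`-leaf is invoked at registration radius `R + 4⌈ρ/4⌉` (`IsGlobalReg.radius_add_four_mul`:
  `Cg ↦ 2ⁿ·Cg`) and paid back to `win R` by the window density ratio (`nK_atomsIn_add_four_mul_le`: `nK(win (R+4n)) ≤ winDensC^{2n}·nK(win R)`, part TV (K_dens) iterated).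
  PACKING (`winsum_le_packing_mul_winsum`, PROVED): the sites of `win R` having an `r`-neighbour in `S` with property `P` number `≤ (2r/δ+1)³ ×` the `P`-sites of `win (R + r)`
  (sum exchange + `card_le_of_separated_of_dist_le`).
* YE-1 ★★ THE BALL CAVEAT ABSORBED (row 1174 (i)).  `IsTameBall ϑ r S H x` (every site of `S` within `r` of `x` has a `ϑ`-tame star), `hotNearCount ϑ r` (sites with a HOT site
  within `r`), `tameBallIncoherentCount ϑ₁ ω₁ ϑ r` (sites with a `ϑ`-tame `r`-BALL that are not `(ϑ₁, ω₁)`-coherent for `Ψ`); leaf [TBISᵇ(r)] `TameBallIncoherenceSparseBPG ϑ₁ ω₁ ϑ r`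
  — (M)'s Caccioppoli-on-balls mechanism gets exactly the hypothesis it wants.  `incoherentCount ≤ tameBallIncoherentCount + hotNearCount` (sitewise), `hotNearCount(win R) ≤
  (2r/δ+1)³·hotCount(win (R + r))` (packing); GLUE ★★ `incoherenceSparseBPG₀_of_hot_tameBallIncoherent` ([ISᵇ₀] ⟸ [HSᵇ] ∧ [TBISᵇ(r)], PROVED, `aHi ≤ 8/7`, `r ≥ 0`) and
  `tameIncoherenceSparseBPG_of_hot_tameBallIncoherent` ([TISᵇ] ⟸ [HSᵇ] ∧ [TBISᵇ(r)]); CERTIFICATES (PROVED): [TISᵇ] ⇒ [TBISᵇ(r)] (a site with a tame ball is tame), [ISᵇ₀] ⇒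
  [TBISᵇ(r)].  [TBISᵇ(r)] is WEAKER than [TISᵇ] and replaces it in the column at NO extra leaf ([HSᵇ] ⟸ [I_D] ∧ [BHSᵇ] is part YD).
* YE-1b ★★ (M) ∧ (K) ON TAME BALLS, TYPED.  `tameBallCubicMass ϑ r S H Q σ W = Σ_{x ∈ W, tame r-ball} (σ x³ + tilt(Q x)³)`; data leaf (MKᵇᵃˡˡ) `TameBallTiltStrainBPG
  ϑ r`: for the GIVEN registered bond isomorphism `Ψ` there are tilt–strain data (part TR) with cubic mass `≤ ε·η·nK` on the tame-balled sites — the output of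
  (K) rigidity on balls and (M) interior decay, with NO hypothesis near hot sites; `tameBallIncoherentCount ≤ (ϑ₁⁻³ + ω₁⁻³)·tameBallCubicMass` (cubic
  Chebyshev, PROVED) ⇒ (MKᵇᵃˡˡ) ⇒ [TBISᵇ(r)] (PROVED) ⇒ with [HSᵇ]: [TISᵇ] (`tameIncoherenceSparseBPG_of_hot_tameBallTiltStrain`, row 1174 (i) fully typed).
  SIDE DOOR, not in the column.
* YE-2 ★★ THE SERENE / AGITATED CUT OF [BHSᵇ] (row 1174 (ii), lens-2 proper).  A site `y` is FAR-WARM (`ϑc`, `ϑ`, `r`) when its `r`-ball is `ϑ`-tame (no hot site within `r`) but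
  its own star is not `ϑc`-tame (`ϑc < ϑ` the «cool» threshold): a TAME OBSERVER that sees strain.  A site `x` is AGITATED (`IsAgitated ϑc ϑ r ra`) when a far-warm site lies
  within `ra` of it — the far field of the hot network around `x` is OBSERVABLY strained — and SERENE otherwise (every tame-balled observer within `ra` is `ϑc`-cool, or there is
  none).  Counts `farWarmCount`, `agitatedCount`, `sereneBareHotCount`; leaves [FWSᵇ] `FarWarmSparseBPG ϑc ϑ r` and ★★ [SBHSᵇ] `SereneBareHotSparseBPG ϑc ϑ r ra ϑe ωe p r₀ ℓ M`
  (SERENE bare hot sites are `o(η)`-sparse).  `bareHotCount ≤ sereneBareHotCount + agitatedCount` (excluded middle), `agitatedCount(win R) ≤ (2ra/δ+1)³·farWarmCount(win (R + ra))`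
  (packing), `farWarmCount ≤ tameBallIncoherentCount` for `ϑ₁ ≤ ϑc` (a coherent star is `ϑ₁`-tame, part YC `IsCoherentBy.isTameOn_of_le`); GLUE ★★ `bareHotSparseBPG_of_serene_farWarm`
  ([BHSᵇ] ⟸ [SBHSᵇ] ∧ [FWSᵇ], PROVED) and `bareHotSparseBPG_of_serene_tameBallIncoherence` ([BHSᵇ] ⟸ [SBHSᵇ] ∧ [TBISᵇ(r)], `ϑ₁ ≤ ϑc`); CERTIFICATES (PROVED): [BHSᵇ] ⇒ [SBHSᵇ]
  (sub-count), [TBISᵇ(r)](ϑ₁) ⇒ [FWSᵇ](ϑc) for `ϑ₁ ≤ ϑc`; ★★★ column `gap_and_pert_1_50_of_certs_16XH23B` = `_16XH22Bᶜ` with [BHSᵇ] ↦ [SBHSᵇ](ϑc = 1/100, r = 8, ra = 16) and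
  [TISᵇ] ↦ [TBISᵇ(8)], each hypothesis implied by the one it replaces (`serene_and_tameBall_of_count_docket`, PROVED); the AGITATED bare hot sites are charged, through the
  far-warm observers, to the (M)/(K)-currency leaf [TBISᵇ] that the column carries anyway.
THE DICHOTOMY (special vs generic) and its mechanisms.  GENERIC = AGITATED: the hot network's far field is visible at tame-balled observers at distance `∈ (r, ra]`, i.e. it is
an elastic SOURCE (net Burgers vector / dipole / misfit: dislocation segments, misfitting lumps, chain ends) — its count is slaved to the observers' count, which is the (M)
higher-integrability currency (`#{σ > ϑc on tame balls} ≤ Σσ^{2+ε}/ϑc^{2+ε} = o(η)·nK`).  SPECIAL = SERENE: the far field is `ϑc`-COOL wherever it is observable — a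
SELF-EQUILIBRATED (screened) hot network; for these the EXCISION calculus applies with a controlled ambient term: (E1) a LOCAL hot gap (the null-Lagrangian-corrected cell excess of
a hot star in the charted fixed-topology class is `≥ c·ϑ²`: finite, certified, non-perturbative but LOCAL), (E2) a FEATHERED excision competitor (thin tube / sheet / small lump replaced by
the chart, feathering cost `≲ (ρ/r)²` of the gain for collar `r ≫` thickness `ρ`), (E3) the AMBIENT COUPLING bound `≤ C·σ_amb·ϑ·#network` with `σ_amb ≤ ϑc` BY SERENITY — so a serene
network is e⋆-GSC-removable once `ϑc ≤ c·ϑ/C`, and [SBHSᵇ] is the typed home of exactly that argument ([BHSᵇ]'s «source chains» split into SOURCES, paid by (M), and SCREENED chains,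
paid by excision).  Honest residual inhabitant of [SBHSᵇ]: BURIED interiors of FAT hot lumps (inradius `> r + ra`: vacuously serene) in ambient strain between `ϑ·√(c/C)` and `ϑ` —
volume-vs-surface excision with a STRAINED tame patch is marginal there (gain `c·ϑ²·V` against `C·σ_amb²·V`); a stress-induced competing phase at `5 %` strain is the bet against.
No proof holes, no new axiom, no instances, no notations, no option overrides; classical indicators via `open scoped Classical` (tree precedent, parts YC/YD).
-/

noncomputable section

open scoped BigOperators Classical
open MeasureTheory Set Metric Filter Topology
open Summit.AtomisticToContinuum.Crystallization.Theorems.ChartedPlanarOrderRigidityDoor (E3 atomsIn VisibleGap PertRegime)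
open Summit.AtomisticToContinuum.Crystallization.Theorems.ChartedPlanarOrderDensityDichotomy (μS IsSep nK nK_nonneg)
open Summit.AtomisticToContinuum.Crystallization.Theorems.ChartedPlanarOrderCleanScaleP (IsCleanP IsDoorSetP)
open Summit.AtomisticToContinuum.Crystallization.Theorems.ChartedPlanarOrderMesoCut (LayeredHom EnvClose)
open Summit.AtomisticToContinuum.Crystallization.Theorems.ChartedPlanarOrderDoorLayered (atomsIn_subset sq_le_finsum_mem PeriodicBulkGapDoor)
open Summit.AtomisticToContinuum.Crystallization.Theorems.ChartedPlanarOrderDoorLayeredOsc (IsTwoShellAffineGood)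
open Literature.MathematicalPhysics.StatisticalMechanics (card_le_of_separated_of_dist_le)

namespace Summit.AtomisticToContinuum.Crystallization.Theorems.ChartedZeroExcessLayeredLatticeLiouville

/-! ### YE-0  The B-body as ONE functional; the sub-count and CHARGING calculus -/

/-- ★ **`CountSparseBPG cnt aHi Λ θ s` — THE B-BODY OF THE SPARSE LEAVES OVER A WINDOW FUNCTIONAL `cnt S H Ψ Q`.**  For every separation `δ`, chart scale `a`, registration
constant `Cg ≥ 1`, tolerance `εw > 0` and fatness `K₀ > 0` there are `η₁ > 0`, `R₁ > 0` such that on every `aHi`-door GSC set `S` with `θ`-good sites, for `η ≤ η₁`, `R ≥ R₁`, every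
equilibrium `(a, s, Λ)`-chart `(L, w)` and every bond isomorphism `Ψ` that is `(Cg, η, R)`-registered into `H = LayeredHom L w`, on a `K₀`-fat window: `cnt S H Ψ (win R) ≤
εw·η·nK(win R)`.  Parts YC/YD's leaves [ISᵇ₀], [HSᵇ], [BHSᵇ], [TISᵇ] ARE `CountSparseBPG` of their functionals (`Iff.rfl` below); every leaf of this file is DEFINED through it, so
that glue and certificates are statements about functionals (`of_pointwise_le`, `of_le_add_mul`). [this file, g62] -/
def CountSparseBPG (cnt : Set E3 → Set E3 → (E3 → E3) → Set E3 → ℝ) (aHi Λ θ s : ℝ) : Prop :=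
  ∀ δ : ℝ, 0 < δ → ∀ a : ℝ, 0 < a → ∀ Cg : ℝ, 1 ≤ Cg →
    ∀ εw : ℝ, 0 < εw → ∀ K₀ : ℝ, 0 < K₀ → ∃ η₁ : ℝ, 0 < η₁ ∧ ∃ R₁ : ℝ, 0 < R₁ ∧
      ∀ S : Set E3, IsDoorSetPG aHi δ S → (∀ q ∈ S, IsTwoShellAffineGood θ S q) →
        ∀ η : ℝ, 0 < η → η ≤ η₁ → ∀ R : ℝ, R₁ ≤ R →
          ∀ (L : E3 ≃L[ℝ] E3) (w : ℤ → E3), IsEquilChart a s Λ L w →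
            ∀ Ψ : E3 → E3, IsGlobalReg Cg η R S (LayeredHom (L : E3 →L[ℝ] E3) w) Ψ → IsBondIso S Ψ →
              K₀ ≤ η * nK (atomsIn (μS S) 0 R) →
                cnt S (LayeredHom (L : E3 →L[ℝ] E3) w) Ψ (atomsIn (μS S) 0 R) ≤ εw * η * nK (atomsIn (μS S) 0 R)

/-- [ISᵇ₀] is `CountSparseBPG` of `incoherentCount` (definitional). [this file, g62] -/
theorem incoherenceSparseBPG₀_iff_count {ϑ₁ ω₁ aHi Λ θ s : ℝ} :
    IncoherenceSparseBPG₀ ϑ₁ ω₁ aHi Λ θ s ↔ CountSparseBPG (fun S _ Ψ Q => incoherentCount ϑ₁ ω₁ S Ψ Q) aHi Λ θ s := Iff.rfl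

/-- [HSᵇ] is `CountSparseBPG` of `hotCount` (definitional). [this file, g62] -/
theorem hotSparseBPG_iff_count {ϑ aHi Λ θ s : ℝ} :
    HotSparseBPG ϑ aHi Λ θ s ↔ CountSparseBPG (fun S H _ Q => hotCount ϑ S H Q) aHi Λ θ s := Iff.rfl

/-- [BHSᵇ] is `CountSparseBPG` of `bareHotCount` (definitional). [this file, g62] -/
theorem bareHotSparseBPG_iff_count {ϑ ϑe ωe : ℝ} {p : ℕ} {r₀ ℓ : ℝ} {M : ℕ} {aHi Λ θ s : ℝ} :
    BareHotSparseBPG ϑ ϑe ωe p r₀ ℓ M aHi Λ θ s ↔ CountSparseBPG (fun S H _ Q => bareHotCount ϑ ϑe ωe p r₀ ℓ M S H Q) aHi Λ θ s := Iff.rfl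

/-- [TISᵇ] is `CountSparseBPG` of `tameIncoherentCount` (definitional). [this file, g62] -/
theorem tameIncoherenceSparseBPG_iff_count {ϑ₁ ω₁ ϑ aHi Λ θ s : ℝ} :
    TameIncoherenceSparseBPG ϑ₁ ω₁ ϑ aHi Λ θ s ↔ CountSparseBPG (fun S H Ψ Q => tameIncoherentCount ϑ₁ ω₁ ϑ S H Ψ Q) aHi Λ θ s := Iff.rfl

/-- ★ **SUB-COUNT CALCULUS (PROVED):** a functional dominated sitewise-in-effect (`cntA ≤ cntB` on finite chunks of `S`, for maps `Ψ` into `H`) inherits sparsity. [this file, g62] -/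
theorem CountSparseBPG.of_pointwise_le {cntA cntB : Set E3 → Set E3 → (E3 → E3) → Set E3 → ℝ} {aHi Λ θ s : ℝ}
    (hle : ∀ (S H : Set E3) (Ψ : E3 → E3) (Q : Set E3), Q.Finite → Q ⊆ S → MapsTo Ψ S H → cntA S H Ψ Q ≤ cntB S H Ψ Q)
    (h : CountSparseBPG cntB aHi Λ θ s) : CountSparseBPG cntA aHi Λ θ s := by
  intro δ hδ a ha Cg hCg εw hεw K₀ hK₀
  obtain ⟨η₁, hη₁, R₁, hR₁, h1⟩ := h δ hδ a ha Cg hCg εw hεw K₀ hK₀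
  exact ⟨η₁, hη₁, R₁, hR₁, fun S hS hgood η hη hηle R hR L w hLw Ψ hΨ hBI hfat =>
    (hle S _ Ψ _ (finite_atomsIn hδ hS.1.2.1 R) (atomsIn_subset S R) hΨ.1.mapsTo).trans (h1 S hS hgood η hη hηle R hR L w hLw Ψ hΨ hBI hfat)⟩

/-- an `r`-neighbour in `S` of a site of `win R` lies in `win (R + r)`. [this file, g62] -/
theorem mem_atomsIn_add_of_dist_le {S : Set E3} {R r : ℝ} {x p : E3} (hx : x ∈ atomsIn (μS S) 0 R) (hp : p ∈ S) (hpx : dist p x ≤ r) :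
    p ∈ atomsIn (μS S) 0 (R + r) := by
  refine mem_atomsIn_iff.2 ⟨hp, ?_⟩
  have hx' := (mem_atomsIn_iff.1 hx).2
  calc ‖p‖ = ‖p - x + x‖ := by rw [sub_add_cancel]
    _ ≤ ‖p - x‖ + ‖x‖ := norm_add_le _ _
    _ ≤ r + R := add_le_add (by rwa [← dist_eq_norm]) hx'
    _ = R + r := by ring

/-- ★ **PACKING / CHARGING LEMMA (PROVED).**  If `g ≤ 1` marks (with a positive value) only sites having an `r`-neighbour `y ∈ S` with property `P`, and `f ≥ 0` gives every
`P`-site weight `≥ 1`, then `Σ_{win R} g ≤ (2r/δ+1)³ · Σ_{win (R + r)} f` on a `δ`-separated `S`: charge each marked site to a `P`-neighbour; a site of `win (R + r)` is charged by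
`≤ (2r/δ+1)³` sites (`card_le_of_separated_of_dist_le`).  Stated over weights `f, g` (not predicates) so that users' classical indicators match syntactically. [this file, g62] -/
theorem winsum_le_packing_mul_winsum {δ : ℝ} (hδ : 0 < δ) {S : Set E3} (hsep : IsSep δ S) {R r : ℝ} (hr : 0 ≤ r) (P : E3 → Prop) {f g : E3 → ℝ}
    (hg1 : ∀ x, g x ≤ 1) (hgP : ∀ x, 0 < g x → ∃ y ∈ S, dist y x ≤ r ∧ P y) (hf0 : ∀ y, 0 ≤ f y) (hf1 : ∀ y, P y → 1 ≤ f y) :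
    ∑ᶠ x ∈ atomsIn (μS S) 0 R, g x ≤ (2 * r / δ + 1) ^ 3 * ∑ᶠ y ∈ atomsIn (μS S) 0 (R + r), f y := by
  have hW := finite_atomsIn hδ hsep R
  have hW' := finite_atomsIn hδ hsep (R + r)
  have hC : (0 : ℝ) ≤ (2 * r / δ + 1) ^ 3 := by positivity
  rw [finsum_mem_eq_finite_toFinset_sum _ hW, finsum_mem_eq_finite_toFinset_sum _ hW', Finset.mul_sum]
  have h1 : ∀ x ∈ hW.toFinset, g x ≤ ∑ y ∈ hW'.toFinset, (if P y ∧ dist y x ≤ r then (1 : ℝ) else 0) := by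
    intro x hx
    have hxW : x ∈ atomsIn (μS S) 0 R := hW.mem_toFinset.1 hx
    have h0 : ∀ y ∈ hW'.toFinset, (0 : ℝ) ≤ (if P y ∧ dist y x ≤ r then (1 : ℝ) else 0) := fun y _ => by split_ifs <;> norm_num
    by_cases hgx : 0 < g x
    · obtain ⟨y, hyS, hyx, hPy⟩ := hgP x hgx
      have hyW' : y ∈ hW'.toFinset := hW'.mem_toFinset.2 (mem_atomsIn_add_of_dist_le hxW hyS hyx)
      have h2 : (if P y ∧ dist y x ≤ r then (1 : ℝ) else 0) = 1 := if_pos ⟨hPy, hyx⟩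
      exact (hg1 x).trans (h2.symm.le.trans (Finset.single_le_sum h0 hyW'))
    · exact (not_lt.1 hgx).trans (Finset.sum_nonneg h0)
  refine (Finset.sum_le_sum h1).trans ?_
  rw [Finset.sum_comm]
  refine Finset.sum_le_sum fun y hy => ?_
  by_cases hPy : P y
  · have h3 : ∑ x ∈ hW.toFinset, (if P y ∧ dist y x ≤ r then (1 : ℝ) else 0)
        = ∑ x ∈ hW.toFinset.filter (fun x => dist y x ≤ r), (1 : ℝ) := by
      rw [Finset.sum_filter]
      refine Finset.sum_congr rfl fun x _ => ?_
      by_cases hd : dist y x ≤ r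
      · rw [if_pos ⟨hPy, hd⟩, if_pos hd]
      · rw [if_neg (fun h => hd h.2), if_neg hd]
    have h4 := card_le_of_separated_of_dist_le (hW.toFinset.filter (fun x => dist y x ≤ r)) y hδ hr
      (fun c hc => by rw [dist_comm]; exact (Finset.mem_filter.1 hc).2)
      (fun c hc d hd hcd => hsep c (mem_atomsIn_iff.1 (hW.mem_toFinset.1 (Finset.mem_filter.1 hc).1)).1 d
        (mem_atomsIn_iff.1 (hW.mem_toFinset.1 (Finset.mem_filter.1 hd).1)).1 hcd)
    rw [finrank_euclideanSpace_fin] at h4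
    rw [h3, Finset.sum_const, nsmul_eq_mul, mul_one]
    exact h4.trans (le_mul_of_one_le_right hC (hf1 y hPy))
  · have h5 : ∑ x ∈ hW.toFinset, (if P y ∧ dist y x ≤ r then (1 : ℝ) else 0) = 0 :=
      Finset.sum_eq_zero fun x _ => if_neg (fun h => hPy h.1)
    rw [h5]
    exact mul_nonneg hC (hf0 y)

/-- RADIUS UP by `4n`: a `(Cg, η, R)`-registration is a `(2ⁿ·Cg, η, R + 4n)`-registration (`R ≥ 4`; part TZ `radius_add_four` iterated). [this file, g62] -/
theorem IsGlobalReg.radius_add_four_mul {Cg η R : ℝ} (hCg : 0 ≤ Cg) (hη : 0 ≤ η) (hR : 4 ≤ R) {S H : Set E3} {Ψ : E3 → E3}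
    (h : IsGlobalReg Cg η R S H Ψ) (n : ℕ) : IsGlobalReg (2 ^ n * Cg) η (R + 4 * n) S H Ψ := by
  induction n with
  | zero => simpa using h
  | succ k ih =>
    have hk4 : (4 : ℝ) ≤ R + 4 * k := by
      have : (0 : ℝ) ≤ 4 * (k : ℝ) := by positivity
      linarith
    have hk := ih.radius_add_four (by positivity) hη hk4
    have e1 : (2 : ℝ) ^ (k + 1) * Cg = 2 * (2 ^ k * Cg) := by ring
    have e2 : R + 4 * ((k + 1 : ℕ) : ℝ) = R + 4 * k + 4 := by push_cast; ring
    rw [e1, e2]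
    exact hk

/-- density ratio `win (R + 4n)` versus `win R` on door sets (`R ≥ 12`, `aHi ≤ 8/7`): `nK(win (R + 4n)) ≤ winDensC^{2n}·nK(win R)` (part TZ iterated). [this file, g62] -/
theorem nK_atomsIn_add_four_mul_le {aHi δ : ℝ} (haHi : aHi ≤ 8 / 7) (hδ : 0 < δ) {S : Set E3} (hS : IsDoorSetP aHi δ S) {R : ℝ} (hR : 12 ≤ R)
    (n : ℕ) : nK (atomsIn (μS S) 0 (R + 4 * n)) ≤ winDensC δ ^ (2 * n) * nK (atomsIn (μS S) 0 R) := by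
  induction n with
  | zero => simp
  | succ k ih =>
    have hk : (12 : ℝ) ≤ R + 4 * k := by
      have : (0 : ℝ) ≤ 4 * (k : ℝ) := by positivity
      linarith
    have h1 := nK_atomsIn_add_four_le haHi hδ hS hk
    have hc : (0 : ℝ) ≤ winDensC δ ^ 2 := pow_nonneg (zero_le_one.trans (one_le_winDensC hδ)) 2
    have e2 : R + 4 * ((k + 1 : ℕ) : ℝ) = R + 4 * k + 4 := by push_cast; ring
    rw [e2]
    calc nK (atomsIn (μS S) 0 (R + 4 * k + 4)) ≤ winDensC δ ^ 2 * nK (atomsIn (μS S) 0 (R + 4 * k)) := h1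
      _ ≤ winDensC δ ^ 2 * (winDensC δ ^ (2 * k) * nK (atomsIn (μS S) 0 R)) := mul_le_mul_of_nonneg_left ih hc
      _ = winDensC δ ^ (2 * (k + 1)) * nK (atomsIn (μS S) 0 R) := by ring

/-- ★★ **CHARGING GLUE (PROVED).**  Let `cntA(win R) ≤ cntB(win R) + C(δ)·cntC(win (R + ρ))` on every `δ`-separated `S` (`C(δ) > 0`, `ρ ≥ 0`), with `cntC ≥ 0` monotone in the
window.  Then `[cntB sparse] ∧ [cntC sparse] ⇒ [cntA sparse]` on `aHi ≤ 8/7` door sets: the `cntC`-leaf is used at registration radius `R + 4n`, `n = ⌈ρ/4⌉₊` (`Cg ↦ 2ⁿ·Cg`,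
fatness is monotone), its window `win (R + 4n) ⊇ win (R + ρ)` is paid back to `win R` by `winDensC^{2n}`, and the tolerances are split `εw/2 + εw/2`. [this file, g62] -/
theorem CountSparseBPG.of_le_add_mul {cntA cntB cntC : Set E3 → Set E3 → (E3 → E3) → Set E3 → ℝ} {aHi Λ θ s ρ : ℝ} {C : ℝ → ℝ}
    (haHi : aHi ≤ 8 / 7) (hC : ∀ δ : ℝ, 0 < δ → 0 < C δ)
    (hle : ∀ δ : ℝ, 0 < δ → ∀ S : Set E3, IsSep δ S → ∀ (H : Set E3) (Ψ : E3 → E3) (R : ℝ),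
      cntA S H Ψ (atomsIn (μS S) 0 R) ≤ cntB S H Ψ (atomsIn (μS S) 0 R) + C δ * cntC S H Ψ (atomsIn (μS S) 0 (R + ρ)))
    (hmono : ∀ (S H : Set E3) (Ψ : E3 → E3) (Q Q' : Set E3), Q'.Finite → Q ⊆ Q' → cntC S H Ψ Q ≤ cntC S H Ψ Q')
    (hB : CountSparseBPG cntB aHi Λ θ s) (hCnt : CountSparseBPG cntC aHi Λ θ s) : CountSparseBPG cntA aHi Λ θ s := by
  intro δ hδ a ha Cg hCg εw hεw K₀ hK₀
  obtain ⟨n, hρn⟩ : ∃ n : ℕ, ρ ≤ 4 * (n : ℝ) := ⟨⌈ρ / 4⌉₊, by have h := Nat.le_ceil (ρ / 4); linarith⟩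
  have hCδ := hC δ hδ
  have hD : (0 : ℝ) < winDensC δ ^ (2 * n) := pow_pos (zero_lt_one.trans_le (one_le_winDensC hδ)) _
  have hε' : 0 < εw / (2 * (C δ * winDensC δ ^ (2 * n))) := div_pos hεw (by positivity)
  have hCg' : (1 : ℝ) ≤ 2 ^ n * Cg := hCg.trans (le_mul_of_one_le_left (zero_le_one.trans hCg) (one_le_pow₀ (by norm_num)))
  obtain ⟨η₂, hη₂, R₂, hR₂, h2⟩ := hB δ hδ a ha Cg hCg (εw / 2) (half_pos hεw) K₀ hK₀
  obtain ⟨η₃, hη₃, R₃, hR₃, h3⟩ := hCnt δ hδ a ha (2 ^ n * Cg) hCg' (εw / (2 * (C δ * winDensC δ ^ (2 * n)))) hε' K₀ hK₀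
  refine ⟨min η₂ η₃, lt_min hη₂ hη₃, max (max R₂ R₃) 12, lt_max_of_lt_left (lt_max_of_lt_left hR₂), ?_⟩
  intro S hS hgood η hη hηle R hR L w hLw Ψ hΨ hBI hfat
  have hR₂' : R₂ ≤ R := ((le_max_left _ _).trans (le_max_left _ _)).trans hR
  have hR₃' : R₃ ≤ R := ((le_max_right _ _).trans (le_max_left _ _)).trans hR
  have hR12 : (12 : ℝ) ≤ R := (le_max_right _ _).trans hR
  have h4n : (0 : ℝ) ≤ 4 * (n : ℝ) := by positivity
  have hsub : atomsIn (μS S) 0 (R + ρ) ⊆ atomsIn (μS S) 0 (R + 4 * n) := atomsIn_mono_radius (by linarith)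
  have hsub' : atomsIn (μS S) 0 R ⊆ atomsIn (μS S) 0 (R + 4 * n) := atomsIn_mono_radius (by linarith)
  have hfin' := finite_atomsIn hδ hS.1.2.1 (R + 4 * n)
  have hΨ' : IsGlobalReg (2 ^ n * Cg) η (R + 4 * n) S (LayeredHom (L : E3 →L[ℝ] E3) w) Ψ :=
    hΨ.radius_add_four_mul (zero_le_one.trans hCg) hη.le (by linarith) n
  have hfat' : K₀ ≤ η * nK (atomsIn (μS S) 0 (R + 4 * n)) := hfat.trans (mul_le_mul_of_nonneg_left (nK_le_nK_of_subset hfin' hsub') hη.le)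
  have hb := h2 S hS hgood η hη (hηle.trans (min_le_left _ _)) R hR₂' L w hLw Ψ hΨ hBI hfat
  have hc := h3 S hS hgood η hη (hηle.trans (min_le_right _ _)) (R + 4 * n) (hR₃'.trans (by linarith)) L w hLw Ψ hΨ' hBI hfat'
  have hdens : nK (atomsIn (μS S) 0 (R + 4 * n)) ≤ winDensC δ ^ (2 * n) * nK (atomsIn (μS S) 0 R) := nK_atomsIn_add_four_mul_le haHi hδ hS.1 hR12 n
  have hcm := hmono S (LayeredHom (L : E3 →L[ℝ] E3) w) Ψ _ _ hfin' hsub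
  have hc' : cntC S (LayeredHom (L : E3 →L[ℝ] E3) w) Ψ (atomsIn (μS S) 0 (R + ρ))
      ≤ εw / (2 * (C δ * winDensC δ ^ (2 * n))) * η * (winDensC δ ^ (2 * n) * nK (atomsIn (μS S) 0 R)) :=
    hcm.trans (hc.trans (mul_le_mul_of_nonneg_left hdens (mul_nonneg hε'.le hη.le)))
  calc cntA S (LayeredHom (L : E3 →L[ℝ] E3) w) Ψ (atomsIn (μS S) 0 R)
      ≤ cntB S (LayeredHom (L : E3 →L[ℝ] E3) w) Ψ (atomsIn (μS S) 0 R) + C δ * cntC S (LayeredHom (L : E3 →L[ℝ] E3) w) Ψ (atomsIn (μS S) 0 (R + ρ)) :=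
        hle δ hδ S hS.1.2.1 _ Ψ R
    _ ≤ εw / 2 * η * nK (atomsIn (μS S) 0 R) + C δ * (εw / (2 * (C δ * winDensC δ ^ (2 * n))) * η * (winDensC δ ^ (2 * n) * nK (atomsIn (μS S) 0 R))) :=
        add_le_add hb (mul_le_mul_of_nonneg_left hc' hCδ.le)
    _ = εw * η * nK (atomsIn (μS S) 0 R) := by
        field_simp
        ring

/-! ### YE-1  The BALL caveat of [TISᵇ] absorbed: tame balls, hot neighbourhoods, [TBISᵇ(r)], `[ISᵇ₀] ⟸ [HSᵇ] ∧ [TBISᵇ(r)]` -/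

/-- **`IsTameBall ϑ r S H x`** — every site of `S` within distance `r` of `x` has a `ϑ`-tame star: BALL-wise tameness about `x`, the hypothesis (M)'s Caccioppoli step (chart
patches re-fitted on balls) actually consumes. [this file, g62] -/
def IsTameBall (ϑ r : ℝ) (S H : Set E3) (x : E3) : Prop := ∀ y ∈ S, dist y x ≤ r → IsTameStar ϑ S H y

/-- a site of `S` with a tame `r`-ball (`r ≥ 0`) is itself tame. [this file, g62] -/
theorem IsTameBall.isTameStar {ϑ r : ℝ} {S H : Set E3} {x : E3} (h : IsTameBall ϑ r S H x) (hx : x ∈ S) (hr : 0 ≤ r) : IsTameStar ϑ S H x :=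
  h x hx (by rw [dist_self]; exact hr)

/-- a site without a tame `r`-ball has a HOT site of `S` within `r`. [this file, g62] -/
theorem exists_hot_of_not_isTameBall {ϑ r : ℝ} {S H : Set E3} {x : E3} (h : ¬ IsTameBall ϑ r S H x) :
    ∃ y ∈ S, dist y x ≤ r ∧ ¬ IsTameStar ϑ S H y := by
  by_contra h'
  push Not at h'
  exact h h'

/-- number of sites of `Q` with a `ϑ`-HOT site of `S` within distance `r` (no tame `r`-ball). [this file, g62] -/
def hotNearCount (ϑ r : ℝ) (S H Q : Set E3) : ℝ :=
  ∑ᶠ x ∈ Q, if (∃ y ∈ S, dist y x ≤ r ∧ ¬ IsTameStar ϑ S H y) then (1 : ℝ) else 0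

/-- number of sites of `Q` with a `ϑ`-tame `r`-BALL that are NOT `(ϑ₁, ω₁)`-coherent for `Ψ`. [this file, g62] -/
def tameBallIncoherentCount (ϑ₁ ω₁ ϑ r : ℝ) (S H : Set E3) (Ψ : E3 → E3) (Q : Set E3) : ℝ :=
  ∑ᶠ x ∈ Q, if IsTameBall ϑ r S H x ∧ ¬ IsCoherentBy ϑ₁ ω₁ S Ψ {x} then (1 : ℝ) else 0

/-- `hotNearCount_nonneg`. [formal bookkeeping] -/
theorem hotNearCount_nonneg (ϑ r : ℝ) (S H Q : Set E3) : 0 ≤ hotNearCount ϑ r S H Q :=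
  finsum_nonneg fun x => finsum_nonneg fun _ => by split_ifs <;> norm_num

/-- `tameBallIncoherentCount_nonneg`. [formal bookkeeping] -/
theorem tameBallIncoherentCount_nonneg (ϑ₁ ω₁ ϑ r : ℝ) (S H : Set E3) (Ψ : E3 → E3) (Q : Set E3) : 0 ≤ tameBallIncoherentCount ϑ₁ ω₁ ϑ r S H Ψ Q :=
  finsum_nonneg fun x => finsum_nonneg fun _ => by split_ifs <;> norm_num

/-- union bound (PROVED): incoherent ⊆ (tame-ball ∧ incoherent) ∪ (no tame ball). [this file, g62] -/
theorem incoherentCount_le_tameBallIncoherent_add_hotNear {ϑ₁ ω₁ ϑ r : ℝ} {S H Q : Set E3} {Ψ : E3 → E3} (hQ : Q.Finite) :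
    incoherentCount ϑ₁ ω₁ S Ψ Q ≤ tameBallIncoherentCount ϑ₁ ω₁ ϑ r S H Ψ Q + hotNearCount ϑ r S H Q := by
  rw [incoherentCount, tameBallIncoherentCount, hotNearCount, finsum_mem_eq_finite_toFinset_sum _ hQ, finsum_mem_eq_finite_toFinset_sum _ hQ,
    finsum_mem_eq_finite_toFinset_sum _ hQ, ← Finset.sum_add_distrib]
  refine Finset.sum_le_sum fun x _ => ?_
  have ha : (0 : ℝ) ≤ (if IsTameBall ϑ r S H x ∧ ¬ IsCoherentBy ϑ₁ ω₁ S Ψ {x} then (1 : ℝ) else 0) := by split_ifs <;> norm_num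
  have hb : (0 : ℝ) ≤ (if (∃ y ∈ S, dist y x ≤ r ∧ ¬ IsTameStar ϑ S H y) then (1 : ℝ) else 0) := by split_ifs <;> norm_num
  by_cases h1 : IsCoherentBy ϑ₁ ω₁ S Ψ {x}
  · rw [if_pos h1]
    exact add_nonneg ha hb
  · rw [if_neg h1]
    by_cases h2 : IsTameBall ϑ r S H x
    · rw [if_pos ⟨h2, h1⟩]
      linarith
    · rw [if_neg (fun h' => h2 h'.1), if_pos (exists_hot_of_not_isTameBall h2)]
      norm_num

/-- CHARGING (PROVED): `hotNearCount(win R) ≤ (2r/δ+1)³ · hotCount(win (R + r))` — each hot site spoils `≤ (2r/δ+1)³` balls. [this file, g62] -/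
theorem hotNearCount_le_packing_mul_hotCount {δ : ℝ} (hδ : 0 < δ) {S : Set E3} (hsep : IsSep δ S) {ϑ R r : ℝ} (hr : 0 ≤ r) (H : Set E3) :
    hotNearCount ϑ r S H (atomsIn (μS S) 0 R) ≤ (2 * r / δ + 1) ^ 3 * hotCount ϑ S H (atomsIn (μS S) 0 (R + r)) := by
  have hg1 : ∀ x : E3, (if (∃ y ∈ S, dist y x ≤ r ∧ ¬ IsTameStar ϑ S H y) then (1 : ℝ) else 0) ≤ 1 := fun x => by split_ifs <;> norm_num
  have hgP : ∀ x : E3, 0 < (if (∃ y ∈ S, dist y x ≤ r ∧ ¬ IsTameStar ϑ S H y) then (1 : ℝ) else 0) →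
      ∃ y ∈ S, dist y x ≤ r ∧ ¬ IsTameStar ϑ S H y := by
    intro x hx
    by_contra h
    rw [if_neg h] at hx
    exact lt_irrefl _ hx
  have hf0 : ∀ y : E3, (0 : ℝ) ≤ (if IsTameStar ϑ S H y then (0 : ℝ) else 1) := fun y => by split_ifs <;> norm_num
  have hf1 : ∀ y : E3, ¬ IsTameStar ϑ S H y → (1 : ℝ) ≤ (if IsTameStar ϑ S H y then (0 : ℝ) else 1) := fun y hy => by rw [if_neg hy]
  exact winsum_le_packing_mul_winsum hδ hsep hr (fun y => ¬ IsTameStar ϑ S H y) hg1 hgP hf0 hf1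

/-- `hotCount` is monotone in the window. [formal bookkeeping] -/
theorem hotCount_mono {ϑ : ℝ} {S H Q Q' : Set E3} (hQ' : Q'.Finite) (h : Q ⊆ Q') : hotCount ϑ S H Q ≤ hotCount ϑ S H Q' :=
  finsum_mem_le_finsum_mem_of_subset_of_nonneg hQ' h fun x _ => by split_ifs <;> norm_num

/-- a tame-ball site that is incoherent is tame and incoherent (`r ≥ 0`): sub-count (PROVED). [this file, g62] -/
theorem tameBallIncoherentCount_le_tameIncoherentCount {ϑ₁ ω₁ ϑ r : ℝ} {S H Q : Set E3} {Ψ : E3 → E3} (hQ : Q.Finite) (hQS : Q ⊆ S) (hr : 0 ≤ r) :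
    tameBallIncoherentCount ϑ₁ ω₁ ϑ r S H Ψ Q ≤ tameIncoherentCount ϑ₁ ω₁ ϑ S H Ψ Q := by
  rw [tameBallIncoherentCount, tameIncoherentCount, finsum_mem_eq_finite_toFinset_sum _ hQ, finsum_mem_eq_finite_toFinset_sum _ hQ]
  refine Finset.sum_le_sum fun x hx => ?_
  have hxS : x ∈ S := hQS (hQ.mem_toFinset.1 hx)
  by_cases h : IsTameBall ϑ r S H x ∧ ¬ IsCoherentBy ϑ₁ ω₁ S Ψ {x}
  · rw [if_pos h, if_pos ⟨h.1.isTameStar hxS hr, h.2⟩]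
  · rw [if_neg h]
    split_ifs <;> norm_num

/-- sub-count (PROVED): tame-ball-incoherent ⊆ incoherent. [this file, g62] -/
theorem tameBallIncoherentCount_le_incoherentCount {ϑ₁ ω₁ ϑ r : ℝ} {S H Q : Set E3} {Ψ : E3 → E3} (hQ : Q.Finite) :
    tameBallIncoherentCount ϑ₁ ω₁ ϑ r S H Ψ Q ≤ incoherentCount ϑ₁ ω₁ S Ψ Q := by
  rw [tameBallIncoherentCount, incoherentCount, finsum_mem_eq_finite_toFinset_sum _ hQ, finsum_mem_eq_finite_toFinset_sum _ hQ]
  refine Finset.sum_le_sum fun x _ => ?_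
  by_cases h1 : IsCoherentBy ϑ₁ ω₁ S Ψ {x}
  · rw [if_neg (fun h' => h'.2 h1), if_pos h1]
  · rw [if_neg h1]
    split_ifs <;> norm_num

/-- ★★ **[TBISᵇ(r)] «TameBallIncoherenceSparseBPG ϑ₁ ω₁ ϑ r aHi Λ θ s» — INCOHERENT SITES WITH A TAME `r`-BALL ARE `o(η)`-SPARSE** (part YD's [TISᵇ] with STAR-wise tameness
`IsTameStar ϑ S H x` strengthened, in the counted predicate, to BALL-wise tameness `IsTameBall ϑ r S H x`; hence a WEAKER leaf: `tameBallIncoherenceSparseBPG_of_tameIncoherence`,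
PROVED).  With [HSᵇ] it gives [ISᵇ₀] back (`incoherenceSparseBPG₀_of_hot_tameBallIncoherent`, PROVED: a site without a tame `r`-ball has a hot site within `r`, and a hot site is
within `r` of `≤ (2r/δ+1)³` sites).  Mechanism = (M)/(K) for the GIVEN `Ψ` on BALLS: on an `r`-ball of `ϑ`-tame stars the chart re-fits patchwise, Caccioppoli modulo rigid
motions + Gehring give higher integrability of the registration strain, and the sites with `σ > ϑ₁` or tilt `> ω₁` are counted by the cubic Chebyshev (part YC
`incoherentCount_le_of_tiltStrainData`) — the ball hypothesis is exactly what that proof consumes, so the honest caveat of [TISᵇ] is gone.  NEW as a typed leaf · (M)/(K)-currency ·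
UNDECIDED((F1) «CoherenceScan» restricted to sites with a tame `8`-ball) · INSTRUMENTABLE · ATTACKABLE·L.
Why it might fail: WARM LENSES far from every hot site (elastic far fields of sources at distance `> r`: dislocation halos have `σ ≍ b/(2πd) > ϑ₁` out to `d ≍ 16`) at density `≍ η`
— `O(η)`, not `o(η)`, unless equilibrium + GSC forbid source densities `≍ η`; the (M) bet is that they do (energy `≍ log`-superlinear in the source strength).
Sources: part YD ([TISᵇ], HONEST PLACEMENT); part YC ((M)/(K) shadows); parts TR/UI; Conti–Dolzmann–Müller, arXiv 1210.2047 (rigidity with mixed growth / higher integrability);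
Friesecke–James–Müller, Comm. Pure Appl. Math. 55 (2002) 1461; CRITIC-LEDGER row 1174 (i). [this file, g62] -/
def TameBallIncoherenceSparseBPG (ϑ₁ ω₁ ϑ r aHi Λ θ s : ℝ) : Prop :=
  CountSparseBPG (fun S H Ψ Q => tameBallIncoherentCount ϑ₁ ω₁ ϑ r S H Ψ Q) aHi Λ θ s

/-- ★★ **GLUE (PROVED): [HSᵇ](ϑ) ∧ [TBISᵇ(r)](ϑ₁, ω₁, ϑ) ⇒ [ISᵇ₀](ϑ₁, ω₁)** on `aHi ≤ 8/7` door sets, `r ≥ 0` — the hot count is consumed on `win (R + r)` through the charging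
glue. [this file, g62] -/
theorem incoherenceSparseBPG₀_of_hot_tameBallIncoherent {ϑ₁ ω₁ ϑ r aHi Λ θ s : ℝ} (haHi : aHi ≤ 8 / 7) (hr : 0 ≤ r) (hH : HotSparseBPG ϑ aHi Λ θ s)
    (hT : TameBallIncoherenceSparseBPG ϑ₁ ω₁ ϑ r aHi Λ θ s) : IncoherenceSparseBPG₀ ϑ₁ ω₁ aHi Λ θ s :=
  incoherenceSparseBPG₀_iff_count.2
    (CountSparseBPG.of_le_add_mul (cntA := fun S _ Ψ Q => incoherentCount ϑ₁ ω₁ S Ψ Q)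
      (cntB := fun S H Ψ Q => tameBallIncoherentCount ϑ₁ ω₁ ϑ r S H Ψ Q) (cntC := fun S H _ Q => hotCount ϑ S H Q)
      (C := fun δ => (2 * r / δ + 1) ^ 3) haHi (fun δ _ => by positivity)
      (fun δ hδ S hsep H Ψ R => (incoherentCount_le_tameBallIncoherent_add_hotNear (finite_atomsIn hδ hsep R)).trans
        (add_le_add le_rfl (hotNearCount_le_packing_mul_hotCount hδ hsep hr H)))
      (fun _ _ _ _ _ hQ' hQQ' => hotCount_mono hQ' hQQ') hT (hotSparseBPG_iff_count.1 hH))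

/-- **[HSᵇ] ∧ [TBISᵇ(r)] ⇒ [TISᵇ] (PROVED)** — row 1174 (i): the star-wise leaf from the ball-wise one plus hot-neighbourhood absorption. [this file, g62] -/
theorem tameIncoherenceSparseBPG_of_hot_tameBallIncoherent {ϑ₁ ω₁ ϑ r aHi Λ θ s : ℝ} (haHi : aHi ≤ 8 / 7) (hr : 0 ≤ r) (hH : HotSparseBPG ϑ aHi Λ θ s)
    (hT : TameBallIncoherenceSparseBPG ϑ₁ ω₁ ϑ r aHi Λ θ s) : TameIncoherenceSparseBPG ϑ₁ ω₁ ϑ aHi Λ θ s :=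
  tameIncoherenceSparseBPG_of_sparse₀ (incoherenceSparseBPG₀_of_hot_tameBallIncoherent haHi hr hH hT)

/-- **[TISᵇ] ⇒ [TBISᵇ(r)] for every `r ≥ 0` (PROVED)** — the new leaf is WEAKER. [this file, g62] -/
theorem tameBallIncoherenceSparseBPG_of_tameIncoherence {ϑ₁ ω₁ ϑ r aHi Λ θ s : ℝ} (hr : 0 ≤ r) (h : TameIncoherenceSparseBPG ϑ₁ ω₁ ϑ aHi Λ θ s) :
    TameBallIncoherenceSparseBPG ϑ₁ ω₁ ϑ r aHi Λ θ s :=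
  CountSparseBPG.of_pointwise_le (fun _ _ _ _ hQ hQS _ => tameBallIncoherentCount_le_tameIncoherentCount hQ hQS hr) (tameIncoherenceSparseBPG_iff_count.1 h)

/-- **[ISᵇ₀] ⇒ [TBISᵇ(r)] (PROVED)** — sub-count, no side condition. [this file, g62] -/
theorem tameBallIncoherenceSparseBPG_of_sparse₀ {ϑ₁ ω₁ ϑ r aHi Λ θ s : ℝ} (h : IncoherenceSparseBPG₀ ϑ₁ ω₁ aHi Λ θ s) :
    TameBallIncoherenceSparseBPG ϑ₁ ω₁ ϑ r aHi Λ θ s :=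
  CountSparseBPG.of_pointwise_le (fun _ _ _ _ hQ _ _ => tameBallIncoherentCount_le_incoherentCount hQ) (incoherenceSparseBPG₀_iff_count.1 h)

end Summit.AtomisticToContinuum.Crystallization.Theorems.ChartedZeroExcessLayeredLatticeLiouville

end
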